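import Summits.HodgeConjecture.HodgeConjecture.Theorems.HeckePrymWeilWeilTwelvefoldsSqrtMinus7CmCurveModel
import HarnessLib

/-!
# Crux `WeilSixfoldsSqrtMinus7` (stmt-HodgeConjecture-1260), line `hyperbolic-eightfold-descent` — sub-goal G1 `stub_cmCurveSeven`: the CM elliptic curve with `√-7` as an endomorphism

Route `HeckePrymWeil`. The registered sub-goal G1 of Stub 7 (the aimed partner at `d = 7`) of the
line's skeleton (`Cruxes/WeilSixfoldsSqrtMinus7/Lines/hyperbolic_eightfold_descent.lean`, r4–r5):
there is a complex abelian variety `E` of dimension `1` with an endomorphism `ι`, `ι ≫ ι = -7` — in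
print the CM curves with `√-7 ∈ End E`, `E = ℂ/ℤ[√-7]` (`j = 16581375`) or `ℂ/ℤ[(1+√-7)/2]`
(`j = -3375`) (B. van Geemen, LNM 1594 (1994), 5.3; Silverman, AEC Thm. VI.4.1 (b)). It is now a
COROLLARY of the sibling line's theorem
`Theorems.WeilTwelvefoldsSqrtMinus7.AmnesicSecantSheaves.exists_cmCurveModel` (crux 1261, seat c1:
the curve `ℂ/(ℤ + ℤ·i√d)` with `[i√d]` as an `AbelianVariety ℂ` endomorphism and its degree-one
model, for every `d ≥ 1`), at `d = 7`, forgetting the cohomological model.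
-/

noncomputable section

-- single-problem summit (Problem = Summit): the mandated namespace repeats `HodgeConjecture`.
set_option linter.dupNamespace false

open CategoryTheory
open Literature.AlgebraicGeometry Literature.AlgebraicGeometry.Motives

namespace Summit.HodgeConjecture.HodgeConjecture.Theorems.WeilSixfoldsSqrtMinus7.HyperbolicEightfoldDescent

/-- **Sub-goal G1 of line `hyperbolic-eightfold-descent`: a complex elliptic curve with an
endomorphism `ι`, `ι ≫ ι = -7`** — the curve `ℂ/(ℤ + ℤ·i√7)` with `ι = [i√7]` of the sibling line's
`exists_cmCurveModel` at `d = 7` (van Geemen, LNM 1594, 5.3: the factor `E` of the CM Weil surface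
`E × E`). [cite: vanGeemen1994HodgeAV, 5.3] [cite: SilvermanAEC2009, Thm. VI.4.1 (b)] -/
theorem stub_cmCurveSeven :
    ∃ (E : AbelianVariety ℂ) (ι : E ⟶ E), E.dim = 1 ∧ ι ≫ ι = -((7 : ℤ) • 𝟙 E) := by
  obtain ⟨E, φ, _x, hE, hφ, -⟩ :=
    Summit.HodgeConjecture.HodgeConjecture.Theorems.WeilTwelvefoldsSqrtMinus7.AmnesicSecantSheaves.exists_cmCurveModel
      7 (by norm_num)
  exact ⟨E, φ, hE, by exact_mod_cast hφ⟩

end Summit.HodgeConjecture.HodgeConjecture.Theorems.WeilSixfoldsSqrtMinus7.HyperbolicEightfoldDescent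

end
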